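import Summits.HodgeConjecture.HodgeConjecture.Theorems.VHCAbelianSchemesRoadSecantAnchorDefs
import Literature.AlgebraicGeometry.HodgeTheory.SecantQuotientAnchorTwistedCarrier
import HarnessLib

/-!
# Road b02 (`VHCAbelianSchemesRoad`, D-0059) — THE SECANT-ANCHOR SET IS INHABITED modulo Markman's PREPRINT (variety level)

research route conditional on HC_CM; not a corollary; Q11.4-sentence-2 already refuted in dim ≥ 3.

CONDITIONAL companion of `…SecantAnchorDefs` / `…SecantAnchor` (seat b02 gen 86; ring2 LEAD gen 151 ruling L151.4; route-independent: it
imports the Defs file and the Literature claim only). The ONE place where the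
preprint is load-bearing for the `(6, 3)` re-cut: the named claim-fact
`Literature.AlgebraicGeometry.HodgeTheory.Markman2025_secantQuotientAnchor_twistedCarrier_sixfold C Adm` (arXiv:2502.03415, UNREFEREED; the
OBJECT-level statement at the quotient anchor `Y_d = (X × X̂)/Ḡ`, `d` even `≥ 4`), taken as a HYPOTHESIS at the crux's door
`AdmTw := gluableSigmaAdmissible ∨ bfSingleAdmissible` (spelled out), gives:

* `secantAnchor_on_copies_of_markman` — for every even `d ≥ 4` a polarised abelian sixfold `(Y, h)` and a rational class `γ ∉ ℂ·h³` such that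
  ON EVERY COPY `e : X' ≅ Y` the class `e^*h` is a secant-anchor class of `X'` (`e^*h ∈ secantAnchorSixfold C X'`) and the plane
  `ℂ·(e^*h)³ + ℂ·e^*γ` is served there (`⊆ secantServedClasses C X' (e^*h)`). The «every copy» form is the TRANSPORT-FREE input of the
  pencil-level witness (ring2-b03, `…SecantAnchorInhabited`): instantiate at `X' := 𝒳_{sₐ}`, `e :=` the chart of the anchor fibre.
* `secantAnchorSixfold_inhabited_of_markman` — the variety-level inhabitation (J's C2 (i)): some `(Y, h)` with `h ∈ secantAnchorSixfold C Y`
  and a served RATIONAL class off the Lefschetz ray; hence `not_forall_not_mem_secantAnchorSixfold_of_markman`: the hypothesis of PART AA's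
  «no anchors ⇒ residual = cell» (`under_not_hasServedFibre_iff_of_forall_not`) FAILS — the anchor half of the partition is not empty.

HONEST CAVEAT (finding F2, ab-andre-2 / LEAD gen 151): at the printed anchors `Y_d ~ J(C)²` (`C` generic) every Hodge class is LEFSCHETZ, so the
served class `γ` lies in `D³(Y_d) ⊗ ℂ`; the claim's content is the semiregular DATUM at `Y_d` (and, through PART AA-b, its transport to the
exceptional fibres of pencils THROUGH `Y_d`), not algebraicity at the anchor; a served pencil INSIDE regime 2 must be a genuine Weil-type pencil
through `Y_d` with a Néron–Severi-rank-one member — a family-supply input, not the constant pencil (PART AA-c is silent here). Nothing in this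
file says any cell, the residual, K-SR♭∃, VHC, `HC_AV` or HC holds; `HC_CM` occurs nowhere; every theorem DISPLAYS the preprint hypothesis.
References: [cite: Markman2025SecantWeil, Thm. 1.4.1, §1.5, Cor. 4.0.4, Remark 9.3.7 and Lemma 9.3.11] [cite: Bloch1972Semiregularity, Remark (7.5)]
[cite: vanGeemen1994HodgeAV, §2.4 and Thm. 4.11].
-/

noncomputable section

open CategoryTheory CategoryTheory.Limits AlgebraicGeometry Topology

namespace Summit.HodgeConjecture.HodgeConjecture.Ring2.SemiregularRepresentatives

-- the cell's namespace repeats the summit name (`Summit.HodgeConjecture.HodgeConjecture…`), as in every `Ring2*` file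
set_option linter.dupNamespace false

open Literature.AlgebraicGeometry Literature.AlgebraicGeometry.Motives
open Literature.AlgebraicGeometry.HodgeTheory
open Literature.AlgebraicTopology.SingularHomology
open Literature.Barriers.HodgeConjecture (divisorClassesSpan)
open Summit.Ventures.HSemireg (ObjClass)

variable {C : ChernCharacterBetti}

/-- Pull-back along an isomorphism preserves «off the Lefschetz ray»: `γ ∉ ℂ·h³ ⟹ e^*γ ∉ ℂ·(e^*h)³`. [cite: HatcherAT2002, Prop. 3.10] -/
theorem map_not_mem_span_cupPowTwo_of_iso {X X' : SchemeOver ℂ} (e : X' ≅ X) {h : complexBetti X 2} {p : ℕ}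
    {γ : complexBetti X (2 * p)} (hγ : γ ∉ (ℂ ∙ cupPowTwo h p)) :
    complexBetti.map e.hom (2 * p) γ ∉ (ℂ ∙ cupPowTwo (complexBetti.map e.hom 2 h) p) := by
  intro hmem
  apply hγ
  obtain ⟨t, ht⟩ := Submodule.mem_span_singleton.1 hmem
  rw [← map_cupPowTwo, ← map_smul] at ht
  have := congrArg (complexBetti.map e.inv (2 * p)) ht
  rw [e.complexBetti_map_inv_map_hom, e.complexBetti_map_inv_map_hom] at this
  exact Submodule.mem_span_singleton.2 ⟨t, this⟩

/-- A pinned datum `κ₃ = γ' + c·θ³` with `γ'` off the ray has `κ₃` off the ray, and its served plane `ℂ·θ³ + ℂ·κ₃` contains `ℂ·θ³ + ℂ·γ'`.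
[cite: Bloch1972Semiregularity, Remark (7.5)] -/
theorem span_pair_le_of_eq_add_smul {X : SchemeOver ℂ} {θ : complexBetti X 2} {p : ℕ} {κp γ' : complexBetti X (2 * p)} {c : ℂ}
    (hκ : κp = γ' + c • cupPowTwo θ p) (hγ' : γ' ∉ (ℂ ∙ cupPowTwo θ p)) :
    κp ∉ (ℂ ∙ cupPowTwo θ p) ∧ Submodule.span ℂ {cupPowTwo θ p, γ'} ≤ Submodule.span ℂ {cupPowTwo θ p, κp} := by
  constructor
  · intro hmem
    apply hγ'
    have : γ' = κp - c • cupPowTwo θ p := by rw [hκ, add_sub_cancel_right]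
    rw [this]
    exact Submodule.sub_mem _ hmem (Submodule.smul_mem _ c (Submodule.mem_span_singleton_self _))
  · refine Submodule.span_le.2 ?_
    rintro x (rfl | rfl)
    · exact Submodule.subset_span (Set.mem_insert _ _)
    · have : x = (-c) • cupPowTwo θ p + (1 : ℂ) • κp := by rw [hκ, one_smul, neg_smul]; abel
      rw [this]
      exact Submodule.mem_span_pair.2 ⟨-c, 1, rfl⟩

/-- **MARKMAN'S QUOTIENT ANCHORS ARE SECANT ANCHORS, ON EVERY COPY (modulo the PREPRINT).** Granted
`Markman2025_secantQuotientAnchor_twistedCarrier_sixfold C AdmTw` (UNREFEREED claim-fact, hypothesis): for every even `d ≥ 4` there are a complex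
abelian sixfold `Y`, a polarisation class `h` and a rational class `γ ∉ ℂ·h³` such that for EVERY copy `e : X' ≅ Y` of the scheme `Y`,
`e^*h ∈ secantAnchorSixfold C X'` and `ℂ·(e^*h)³ + ℂ·e^*γ ⊆ secantServedClasses C X' (e^*h)`. Transport-free input of the pencil-level witness.
[cite: Markman2025SecantWeil, Thm. 1.4.1, §1.5 and Cor. 4.0.4] [cite: Bloch1972Semiregularity, Remark (7.5)] -/
theorem secantAnchor_on_copies_of_markman
    (hM : Markman2025_secantQuotientAnchor_twistedCarrier_sixfold C
      (fun n X₀ I E => Summit.Ventures.HSemireg.gluableSigmaAdmissible n X₀ I E ∨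
        Literature.AlgebraicGeometry.HodgeTheory.bfSingleAdmissible n X₀ I E))
    {d : ℕ} (hd : Even d) (h4 : 4 ≤ d) :
    ∃ (Y : AbelianVariety ℂ) (h : complexBetti Y.X 2) (γ : complexBetti Y.X (2 * 3)),
      Y.dim = 6 ∧ IsPolarizationClass 6 Y.X h ∧ IsRationalClass γ ∧ γ ∉ (ℂ ∙ cupPowTwo h 3) ∧
      ∀ (X' : SchemeOver ℂ) (e : X' ≅ Y.X),
        complexBetti.map e.hom 2 h ∈ secantAnchorSixfold C X' ∧
        (Submodule.span ℂ {cupPowTwo (complexBetti.map e.hom 2 h) 3, complexBetti.map e.hom (2 * 3) γ} :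
            Set (complexBetti X' (2 * 3))) ⊆ secantServedClasses C X' (complexBetti.map e.hom 2 h) := by
  obtain ⟨P, Y, ψ₀, q, h, γ, -, hY, -, -, hpol, -, hγQ, hγoff, -, hdat⟩ := hM d hd h4
  refine ⟨Y, h, γ, hY, hpol, hγQ, hγoff, fun X' e ↦ ?_⟩
  obtain ⟨I, κ, c, h3, h𝒪, hκ3, hκk⟩ := hdat X' e
  obtain ⟨hoff, hle⟩ := span_pair_le_of_eq_add_smul hκ3 (map_not_mem_span_cupPowTwo_of_iso e hγoff)
  -- the off-ray pinned class `κ 3` at `(X', e^*h)`, read off the definitions of `…SecantAnchorDefs`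
  have hv : κ 3 ∈ pinnedOffRayClassesAt (Literature.AlgebraicGeometry.HodgeTheory.twistedReflexiveClass C
      (fun n X₀ I E => Summit.Ventures.HSemireg.gluableSigmaAdmissible n X₀ I E ∨
        Literature.AlgebraicGeometry.HodgeTheory.bfSingleAdmissible n X₀ I E)) 6 3 X' (complexBetti.map e.hom 2 h) :=
    ⟨hoff, I, κ, c, h3, h𝒪, rfl, hκk⟩
  refine ⟨⟨κ 3, hv⟩, fun w hw ↦ ?_⟩
  simp only [secantServedClasses, carrierServedClassesAt, Set.mem_iUnion, SetLike.mem_coe, exists_prop]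
  exact ⟨κ 3, hv, hle hw⟩

/-- **THE SECANT-ANCHOR SET IS INHABITED modulo the PREPRINT (variety level; J's C2 (i)):** some polarised abelian sixfold `(Y, h)` has
`h ∈ secantAnchorSixfold C Y` with a served RATIONAL class `w` off the Lefschetz ray `ℂ·h³` (namely Markman's `γ`, the Weil component of
`κ₃(𝓔̄)`, for any even `d ≥ 4` — here `d = 4`). [cite: Markman2025SecantWeil, Thm. 1.4.1, §1.5 and Cor. 4.0.4] [cite: Bloch1972Semiregularity, Remark (7.5)] -/
theorem secantAnchorSixfold_inhabited_of_markman
    (hM : Markman2025_secantQuotientAnchor_twistedCarrier_sixfold C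
      (fun n X₀ I E => Summit.Ventures.HSemireg.gluableSigmaAdmissible n X₀ I E ∨
        Literature.AlgebraicGeometry.HodgeTheory.bfSingleAdmissible n X₀ I E)) :
    ∃ (Y : AbelianVariety ℂ) (h : complexBetti Y.X 2), Y.dim = 6 ∧ IsPolarizationClass 6 Y.X h ∧
      h ∈ secantAnchorSixfold C Y.X ∧
      ∃ w ∈ secantServedClasses C Y.X h, IsRationalClass w ∧ w ∉ (ℂ ∙ cupPowTwo h 3) := by
  obtain ⟨Y, h, γ, hY, hpol, hγQ, hγoff, hcop⟩ :=
    secantAnchor_on_copies_of_markman hM (d := 4) (by decide) le_rfl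
  obtain ⟨hanc, hserved⟩ := hcop Y.X (Iso.refl _)
  simp only [Iso.refl_hom, complexBetti.map_id] at hanc hserved
  exact ⟨Y, h, hY, hpol, hanc, γ, hserved (Submodule.subset_span (Set.mem_insert_of_mem _ (Set.mem_singleton γ))), hγQ, hγoff⟩

/-- **Hence the «no anchors» degeneration of PART AA does NOT apply to the secant instance (modulo the PREPRINT):** it is false that no
`(X, θ)` is a secant anchor — the hypothesis of `under_not_hasServedFibre_iff_of_forall_not` (no anchors ⇒ residual ↔ cell) FAILS.
[cite: Markman2025SecantWeil, Thm. 1.4.1 and §1.5] -/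
theorem not_forall_not_mem_secantAnchorSixfold_of_markman
    (hM : Markman2025_secantQuotientAnchor_twistedCarrier_sixfold C
      (fun n X₀ I E => Summit.Ventures.HSemireg.gluableSigmaAdmissible n X₀ I E ∨
        Literature.AlgebraicGeometry.HodgeTheory.bfSingleAdmissible n X₀ I E)) :
    ¬ ∀ (X : SchemeOver ℂ) (θ : complexBetti X 2), θ ∉ secantAnchorSixfold C X := by
  intro hnone
  obtain ⟨Y, h, -, -, hanc, -⟩ := secantAnchorSixfold_inhabited_of_markman hM
  exact hnone Y.X h hanc

end Summit.HodgeConjecture.HodgeConjecture.Ring2.SemiregularRepresentatives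

end
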